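import Summits.KontsevichZagierPeriods.KontsevichZagierPeriods.Theses.GaussManinCertificates
import Literature.ModelTheory.ExponentialFields.CylindricalDecompositionProofs
import Literature.NumberTheory.Transcendental.KZLogCalculusProofs
import Literature.NumberTheory.Transcendental.KZDominatedFamilyRelations
import Literature.NumberTheory.Transcendental.KZSemiCanonicalReductionProofs

/-!
# `KZStokes` (stmt-KontsevichZagierPeriods-3012), file 3/4: Newton–Leibniz on one open band (piece X₂)

Route `GaussManinCertificates`, crux `KZStokes`.  Third of the four files re-homing the crux
strategist's complete proof `Cruxes/KZStokes/Lines/KZStokesProof.lean` under `Theorems/` (lead c10 of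
crux stmt-KontsevichZagierPeriods-9129; proof text verbatim; this file is independent of files 1–2):

* `kzStokesBand` — the registered stub `stub_kzStokesBand` of line `runs_and_bands` (piece X₂ of the
  typed decomposition of `KZStokes`), verbatim: for `r : KZ.IntegralRep (n + 1)` whose domain is the
  open band `{(x, t) | x ∈ S, a x < t < b x}` over a `ℚ`-semialgebraic base with `ℚ`-semialgebraic
  edges, and a primitive `H`, `ℚ`-semialgebraic on the closed band, fibrewise continuous on
  `[a x, b x]`, vanishing at both ends and with derivative `r.integrand` on `(a x, b x)`,
  `[r] ∈ KZ.relations` — ONE instance of `KZ.newtonLeibnizRel` (band representation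
  `[closed band, r.integrand extended by 0]` over the zero representation on `S`), plus domain
  additivity across the two null edge graphs, exactly as in `Theorems/GaussManinCertificatesKZStokesBox`.

No named fact is assumed; no new definition; axioms `propext`, `Classical.choice`, `Quot.sound` only.
References: Kontsevich–Zagier 2001, §1.2 (rules 1) and 3)).
-/

noncomputable section

open MeasureTheory Set Filter Topology
open Literature.ModelTheory.ExponentialFields
open Literature.NumberTheory.Transcendental

namespace Summit.KontsevichZagierPeriods.GaussManinCertificates

/-! ### Piece X₂: Newton–Leibniz on one open band -/

/-- **`KZStokesBand`** (piece X₂ of the typed decomposition of `KZStokes`; the statement is, verbatim,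
the registered stub `stub_kzStokesBand` of line `runs_and_bands` of crux stmt-KontsevichZagierPeriods-3012):
Newton–Leibniz on one open band over a `ℚ`-semialgebraic base with a primitive vanishing at both ends
puts `[r]` in `KZ.relations`. [Kontsevich–Zagier 2001, §1.2, rules 1) and 3)] -/
theorem kzStokesBand :
    ∀ (n : ℕ) (S : Set (Fin n → ℝ)) (a b : (Fin n → ℝ) → ℝ) (r : Literature.NumberTheory.Transcendental.KZ.IntegralRep (n + 1)) (H : (Fin (n + 1) → ℝ) → ℝ), Literature.ModelTheory.ExponentialFields.IsSemialgebraic ℚ S → Literature.NumberTheory.Transcendental.IsSemialgebraicFunOn ℚ S a → Literature.NumberTheory.Transcendental.IsSemialgebraicFunOn ℚ S b → (∀ x ∈ S, a x < b x) → r.domain = {z : Fin (n + 1) → ℝ | Fin.init z ∈ S ∧ z (Fin.last n) ∈ Set.Ioo (a (Fin.init z)) (b (Fin.init z))} → Literature.NumberTheory.Transcendental.IsSemialgebraicFunOn ℚ {z : Fin (n + 1) → ℝ | Fin.init z ∈ S ∧ z (Fin.last n) ∈ Set.Icc (a (Fin.init z)) (b (Fin.init z))} H → (∀ x ∈ S,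 ContinuousOn (fun s : ℝ => H (Fin.snoc x s)) (Set.Icc (a x) (b x)) ∧ H (Fin.snoc x (a x)) = 0 ∧ H (Fin.snoc x (b x)) = 0 ∧ ∀ t ∈ Set.Ioo (a x) (b x), HasDerivAt (fun s : ℝ => H (Fin.snoc x s)) (r.integrand (Fin.snoc x t)) t) → Literature.NumberTheory.Transcendental.KZ.of r ∈ Literature.NumberTheory.Transcendental.KZ.relations := by
  intro n S a b r H hS ha hb hab hdom hH hfib
  -- the closed band
  set Bd : Set (Fin (n + 1) → ℝ) := KZlog.band S a b with hBd_def
  have hBd : IsSemialgebraic ℚ Bd := KZlog.isSemialgebraic_band ha hb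
  have hOB : r.domain ⊆ Bd := by
    intro z hz
    rw [hdom] at hz
    exact ⟨hz.1, hz.2.1.le, hz.2.2.le⟩
  have hHB : IsSemialgebraicFunOn ℚ Bd H := by
    have hEq : {z : Fin (n + 1) → ℝ | Fin.init z ∈ S ∧
        z (Fin.last n) ∈ Icc (a (Fin.init z)) (b (Fin.init z))} = Bd := by
      ext z
      simp only [mem_setOf_eq, mem_Icc, hBd_def, KZlog.mem_band]
    rw [← hEq]
    exact hH
  -- the band integrand: `r.integrand` extended by zero off the open band
  set g : (Fin (n + 1) → ℝ) → ℝ := r.domain.indicator r.integrand with hg_def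
  have hgS : IsSemialgebraicFunOn ℚ Bd g := by
    have h1 : IsSemialgebraicFunOn ℚ r.domain g :=
      r.isSemialgebraicFunOn_integrand.congr fun z hz => (indicator_of_mem hz _).symm
    have h2 : IsSemialgebraicFunOn ℚ (Bd \ r.domain) g :=
      (isSemialgebraicFunOn_ratCast (hBd.diff r.isSemialgebraic_domain) 0).congr fun z hz => by
        simp [hg_def, indicator_of_notMem hz.2]
    have h := h1.union h2 (fun _ _ => rfl) (fun _ _ => rfl)
    rwa [Set.union_sdiff_cancel hOB] at h
  have hmeas : MeasurableSet r.domain := KZ.IntegralRep.measurableSet_domain_holds r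
  have hgI : IntegrableOn g Bd := ((integrable_indicator_iff hmeas).mpr r.integrableOn).integrableOn
  let R : KZ.IntegralRep (n + 1) := ⟨Bd, g, hBd, hgS, hgI⟩
  -- the base of the move: the zero representation on `S`
  obtain ⟨Z, hZd, hZi⟩ := KZ.exists_zeroRep hS
  have hZ : KZ.of Z ∈ KZ.relations := KZ.of_mem_relations_of_eqOn_zero Z (by simp [hZi, EqOn])
  -- fibre points of the open band
  have hsnoc : ∀ x ∈ S, ∀ t ∈ Ioo (a x) (b x), (Fin.snoc x t : Fin (n + 1) → ℝ) ∈ r.domain := by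
    intro x hx t ht
    rw [hdom]
    simp only [mem_setOf_eq, Fin.init_snoc, Fin.snoc_last]
    exact ⟨hx, ht⟩
  -- ONE Newton–Leibniz move: `[R] − [Z]`
  have hNL : KZ.of R - KZ.of Z ∈ KZ.relations := by
    refine KZ.newtonLeibnizRel_subset_relations ⟨n, R, Z, a, b, H, hHB, by rw [hZd]; exact ha,
      by rw [hZd]; exact hb, fun x hx => ?_, by rw [hZd]; rfl, fun x hx => ?_, fun x hx t ht => ?_,
      fun x hx => ?_, rfl⟩
    · rw [hZd] at hx
      exact (hab x hx).le
    · rw [hZd] at hx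
      exact (hfib x hx).1
    · rw [hZd] at hx
      have h := (hfib x hx).2.2.2 t ht
      show HasDerivAt (fun s : ℝ => H (Fin.snoc x s)) (g (Fin.snoc x t)) t
      rw [hg_def, indicator_of_mem (hsnoc x hx t ht)]
      exact h
    · rw [hZd] at hx
      rw [hZi, (hfib x hx).2.1, (hfib x hx).2.2.1]
      simp
  have hR : KZ.of R ∈ KZ.relations := by
    simpa using KZ.relations.add_mem hNL hZ
  -- the two edge graphs are null
  have hnull : volume (R.domain \ r.domain) = 0 := by
    have hcov : R.domain \ r.domain ⊆
        {z : Fin (n + 1) → ℝ | Fin.init z ∈ S ∧ z (Fin.last n) = a (Fin.init z)} ∪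
          {z : Fin (n + 1) → ℝ | Fin.init z ∈ S ∧ z (Fin.last n) = b (Fin.init z)} := by
      rintro z ⟨⟨hzS, h1, h2⟩, hz⟩
      rw [hdom] at hz
      simp only [mem_setOf_eq, mem_Ioo, not_and] at hz
      rcases h1.eq_or_lt with h | h
      · exact Or.inl ⟨hzS, h.symm⟩
      · refine Or.inr ⟨hzS, le_antisymm h2 (not_lt.mp fun h' => hz hzS h h')⟩
    exact measure_mono_null hcov
      (measure_union_null (KZ.volume_graph_eq_zero ha) (KZ.volume_graph_eq_zero hb))
  -- `[R] − [R|open band]` and `[R|open band] − [r]` are relations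
  have h2 : KZ.of R - KZ.of (R.restrict r.domain r.isSemialgebraic_domain hOB) ∈ KZ.relations :=
    R.of_sub_of_restrict_mem_relations r.isSemialgebraic_domain hOB hnull
  have h3 : KZ.of (R.restrict r.domain r.isSemialgebraic_domain hOB) - KZ.of r ∈ KZ.relations :=
    KZ.of_sub_of_mem_relations_of_eqOn rfl fun z hz => indicator_of_mem hz _
  have heq : KZ.of r = KZ.of R - (KZ.of R - KZ.of (R.restrict r.domain r.isSemialgebraic_domain hOB)) -
      (KZ.of (R.restrict r.domain r.isSemialgebraic_domain hOB) - KZ.of r) := by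
    abel
  rw [heq]
  exact KZ.relations.sub_mem (KZ.relations.sub_mem hR h2) h3

end Summit.KontsevichZagierPeriods.GaussManinCertificates
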